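import Mathlib
import HarnessLib
import Literature.Probability.LatticeModels.IsingLimitLaw
import Literature.Probability.LatticeModels.IsingLimitLawTilt
import Literature.Probability.LatticeModels.IsingLimitLawLaplace
import Summits.RiemannHypothesis.RiemannHypothesis.Theorems.LeeYangLeeyangPolyaKernelIsingLimitDefs
import Summits.RiemannHypothesis.RiemannHypothesis.Theorems.LeeYangLeeyangPolyaKernelIsingLimitStubMomentsHelpers
import Summits.RiemannHypothesis.RiemannHypothesis.Theorems.LeeYangLeeyangPolyaKernelIsingLimitStubMomentsCone

/-!
# Uniform Gaussian-exponential moments of the witness chains: stub `stub_moments` (crux stmt-RiemannHypothesis-0453)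

Line `telegraph-bessel-chain` of the crux `LeeYang.LeeyangPolyaKernelIsingLimit`, lead prover.
For the scaled witness chains `ν_k` (sites `0..N_k`, uniform weights `η_k/κ₀`, bond parameters
`c_m = e^{−2η_k r(t_{m+1})}`) we prove `sup_k ∫ e^{bu²} dν_k < ∞` for every real `b`, from three
inputs taken as hypotheses (they are the neighbouring stubs `stub_transfer`, `stub_cone` and the
consequence `r ≥ v` of `stub_rate`):

1. (`mgf_ofReal_eq`) by the transfer identity the Laplace transform is
   `∫ e^{hu} dν_k = S_N(h/κ₀)/2`, `S_N` the first component of the real-`h` transfer recursion;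
2. (`cone_chain`, `exponent_le`) the cone invariant with the profile
   `κ_m = min(1, max(2h e^{−t_m}/a, 4hη))` — admissible because `1 − c_m ≥ 1 − e^{−u} ≥ u/(1+u)`,
   `u = 2ηae^{t_{m+1}}` — gives `S_N(h) ≤ 2 exp((N+1)(hη)²/2 + hη Σ κ_m)`, and
   `min(1, x) ≤ √x` plus a geometric sum (`Σ_{m<N} e^{−t_m/2} ≤ 2/η`) bound the exponent by
   `2√2 h√h/√a + 5η_k(T_k+1) h²`;
3. (`integral_exp_mul_sq_isingMagnetizationLaw_le_of_mgf_le`, Helpers file) Hubbard–Stratonovich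
   turns `∫e^{hu} ≤ exp(A|h|√|h| + ε_k h²)` into `∫ e^{bu²} ≤ C(A,b)` once `8bε_k ≤ 1`, which holds
   for large `k` since `ε_k = 5η_k(T_k+1)/κ₀² → 0`; the finitely many small `k` are bounded by the
   support (`|M| ≤ (N+1)η/κ₀`).

Everything is elementary; no literature fact is used. [folklore]
-/

noncomputable section

namespace Summit.RiemannHypothesis.RiemannHypothesis.Theorems.LeeYangTelegraph

open MeasureTheory Filter Topology Complex
open Literature.Probability.LatticeModels Literature.Analysis.Complex.Polya1926

/-! ### Private copies of two glue lemmas of the skeleton -/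

/-- `tanh(artanh c) = c` for `0 ≤ c < 1`. [folklore] -/
private lemma tanh_couplingOfTanh' {c : ℝ} (h0 : 0 ≤ c) (h1 : c < 1) :
    Real.tanh (couplingOfTanh c) = c := by
  have h1c : 0 < 1 - c := by linarith
  have hq : 0 < (1 + c) / (1 - c) := div_pos (by linarith) h1c
  have h2x : Real.exp (2 * couplingOfTanh c) = (1 + c) / (1 - c) := by
    rw [couplingOfTanh, show 2 * (Real.log ((1 + c) / (1 - c)) / 2) =
      Real.log ((1 + c) / (1 - c)) by ring, Real.exp_log hq]
  rw [Real.tanh_eq]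
  have key : (Real.exp (couplingOfTanh c) - Real.exp (-couplingOfTanh c)) /
      (Real.exp (couplingOfTanh c) + Real.exp (-couplingOfTanh c)) =
      (Real.exp (2 * couplingOfTanh c) - 1) / (Real.exp (2 * couplingOfTanh c) + 1) := by
    rw [Real.exp_neg, two_mul, Real.exp_add]
    field_simp
  rw [key, h2x]
  field_simp
  ring

/-- The transfer recursion only depends on the products `z · w m`. [folklore] -/
private lemma sdIter_congr' {z z' : ℂ} {w w' : ℕ → ℝ} (c : ℕ → ℝ)
    (h : ∀ m, z * w m = z' * w' m) (m : ℕ) : sdIter z w c m = sdIter z' w' c m := by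
  induction m with
  | zero => simp only [sdIter, h 0]
  | succ m ih => simp only [sdIter, ih, h (m + 1)]

/-! ### The Laplace transform of the scaled chain -/

section Chain

variable {a κ₀ : ℝ}

/-- **Laplace transform of the scaled chain** (from the transfer identity): for real `h`,
`∫ e^{hu} dν_k = S_N(h/κ₀)/2` with `S_N` the first component of `sdIter (h/κ₀) (const η_k) c`.
[folklore] -/
private lemma mgf_ofReal_eq
    (htransfer : ∀ (N : ℕ) (K w : ℕ → ℝ) (z : ℂ),
      ∫ u, Complex.exp (z * u)
          ∂(isingMagnetizationLaw (N + 1) (chainJ (N + 1) K) (fun i => w i.val) : Measure ℝ) =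
        (sdIter z w (fun m => Real.tanh (K m)) N).1 / 2)
    (hr1 : ∀ t : ℝ, a * Real.exp t ≤ flipRate a t) (ha : 0 < a) (k : ℕ) (h : ℝ) :
    ((∫ u, Real.exp (h * u) ∂(isingMagnetizationLaw (nBonds k + 1) (chainJ (nBonds k + 1) (chainK a k))
        (fun _ => mesh k / κ₀) : Measure ℝ) : ℝ) : ℂ) =
      (sdIter ((h / κ₀ : ℝ) : ℂ) (fun _ => mesh k) (bondTanh a k) (nBonds k)).1 / 2 := by
  have h1 := htransfer (nBonds k) (chainK a k) (fun _ => mesh k / κ₀) (h : ℂ)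
  have h2 : ∫ u, Complex.exp ((h : ℂ) * u) ∂(isingMagnetizationLaw (nBonds k + 1)
      (chainJ (nBonds k + 1) (chainK a k)) (fun _ => mesh k / κ₀) : Measure ℝ) =
      ((∫ u, Real.exp (h * u) ∂(isingMagnetizationLaw (nBonds k + 1)
        (chainJ (nBonds k + 1) (chainK a k)) (fun _ => mesh k / κ₀) : Measure ℝ) : ℝ) : ℂ) := by
    rw [← integral_complex_ofReal]
    refine integral_congr_ae (Eventually.of_forall fun u => ?_)
    show Complex.exp ((h : ℂ) * u) = ((Real.exp (h * u) : ℝ) : ℂ)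
    rw [Complex.ofReal_exp]
    push_cast
    ring_nf
  rw [← h2, h1]
  have htanh : (fun m => Real.tanh (chainK a k m)) = bondTanh a k := funext fun m =>
    tanh_couplingOfTanh' (bondTanh_mem' hr1 ha k m).1.le (bondTanh_mem' hr1 ha k m).2
  rw [htanh, sdIter_congr' (bondTanh a k) (z' := ((h / κ₀ : ℝ) : ℂ)) (w' := fun _ => mesh k)]
  intro m
  push_cast
  field_simp

/-- The Laplace transform of a magnetization law is even in `h` (spin flip). [folklore] -/
private lemma mgf_even' {n : ℕ} (J : Fin n → Fin n → ℝ) (w : Fin n → ℝ) (h : ℝ) :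
    ∫ u, Real.exp (-h * u) ∂(isingMagnetizationLaw n J w : Measure ℝ) =
      ∫ u, Real.exp (h * u) ∂(isingMagnetizationLaw n J w : Measure ℝ) := by
  have e1 := integral_exp_isingMagnetizationLaw J w (h : ℂ)
  have e2 := integral_exp_isingMagnetizationLaw J w (-(h : ℂ))
  rw [isingFieldPartition_neg, ← e1] at e2
  apply Complex.ofReal_injective
  rw [← integral_complex_ofReal, ← integral_complex_ofReal]
  have l1 : ∫ u, ((Real.exp (-h * u) : ℝ) : ℂ) ∂(isingMagnetizationLaw n J w : Measure ℝ) =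
      ∫ u, Complex.exp (-(h : ℂ) * u) ∂(isingMagnetizationLaw n J w : Measure ℝ) :=
    integral_congr_ae (Eventually.of_forall fun u => by
      show ((Real.exp (-h * u) : ℝ) : ℂ) = Complex.exp (-(h : ℂ) * u)
      rw [Complex.ofReal_exp]; push_cast; ring_nf)
  have l2 : ∫ u, ((Real.exp (h * u) : ℝ) : ℂ) ∂(isingMagnetizationLaw n J w : Measure ℝ) =
      ∫ u, Complex.exp ((h : ℂ) * u) ∂(isingMagnetizationLaw n J w : Measure ℝ) :=
    integral_congr_ae (Eventually.of_forall fun u => by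
      show ((Real.exp (h * u) : ℝ) : ℂ) = Complex.exp ((h : ℂ) * u)
      rw [Complex.ofReal_exp]; push_cast; ring_nf)
  rw [l1, l2, e2]

/-- Support bound: `∫ e^{bu²} dν_k ≤ exp(b ((N+1)η/κ₀)²)` for `b ≥ 0` (all weights are `η/κ₀ ≥ 0`,
so `|M| ≤ (N+1)η/κ₀`). [folklore] -/
private lemma integral_exp_mul_sq_le_support (hκ₀ : 0 < κ₀) (k : ℕ) {b : ℝ} (hb : 0 ≤ b) :
    ∫ u, Real.exp (b * u ^ 2) ∂(isingMagnetizationLaw (nBonds k + 1)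
        (chainJ (nBonds k + 1) (chainK a k)) (fun _ => mesh k / κ₀) : Measure ℝ) ≤
      Real.exp (b * ((nBonds k + 1) * (mesh k / κ₀)) ^ 2) := by
  set J := chainJ (nBonds k + 1) (chainK a k)
  set w : Fin (nBonds k + 1) → ℝ := fun _ => mesh k / κ₀
  have hw : 0 ≤ mesh k / κ₀ := (div_pos ((mesh_pos' k).2.2) hκ₀).le
  rw [integral_isingMagnetizationLaw_eq_sum J w
    (by fun_prop : Continuous fun u : ℝ => Real.exp (b * u ^ 2)).stronglyMeasurable]
  have hM : ∀ s : Fin (nBonds k + 1) → Bool,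
      |weightedMagnetization w s| ≤ (nBonds k + 1) * (mesh k / κ₀) := by
    intro s
    unfold weightedMagnetization
    calc |∑ i, w i * spinVal s i| ≤ ∑ i, |w i * spinVal s i| := Finset.abs_sum_le_sum_abs _ _
      _ = ∑ _i : Fin (nBonds k + 1), mesh k / κ₀ := by
          refine Finset.sum_congr rfl fun i _ => ?_
          rw [abs_mul, abs_of_nonneg hw]
          unfold spinVal; split_ifs <;> simp
      _ = (nBonds k + 1) * (mesh k / κ₀) := by simp
  calc ∑ s : Fin (nBonds k + 1) → Bool, (isingBoltzmann J s / isingPairPartition J) •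
        Real.exp (b * weightedMagnetization w s ^ 2)
      ≤ ∑ s : Fin (nBonds k + 1) → Bool, (isingBoltzmann J s / isingPairPartition J) •
        Real.exp (b * ((nBonds k + 1) * (mesh k / κ₀)) ^ 2) := by
        refine Finset.sum_le_sum fun s _ => ?_
        rw [smul_eq_mul, smul_eq_mul]
        refine mul_le_mul_of_nonneg_left (Real.exp_le_exp.2 ?_)
          (div_nonneg (isingBoltzmann_pos J s).le (isingPairPartition_pos J).le)
        refine mul_le_mul_of_nonneg_left ?_ hb
        have h1 := hM s
        have h2 : 0 ≤ (nBonds k + 1) * (mesh k / κ₀) := by positivity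
        rw [← sq_abs]
        exact pow_le_pow_left₀ (abs_nonneg _) h1 2
    _ = Real.exp (b * ((nBonds k + 1) * (mesh k / κ₀)) ^ 2) := by
        rw [← Finset.sum_smul, smul_eq_mul]
        have : ∑ s : Fin (nBonds k + 1) → Bool, isingBoltzmann J s / isingPairPartition J = 1 := by
          rw [← Finset.sum_div, div_eq_one_iff_eq (isingPairPartition_pos J).ne']
          rfl
        rw [this, one_mul]

end Chain

/-! ### The stub -/

/-- STUB `stub_moments` of the skeleton `Cruxes/LeeyangPolyaKernelIsingLimit/Lines/Sketch.lean`.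
**Uniform Gaussian-exponential moments of the witness chains**: from the transfer identity, the
cone bound (with `κ_m = min(1, max(2h e^{−t_m}/a, 4hη))`, giving
`E e^{hM} ≤ exp(2√2 h√h/√a + 5η_k(T_k+1)h²)` for the unscaled chain, `h ≥ 0`) and
Hubbard–Stratonovich `e^{bu²} = E_g e^{√(2b) g u}`, the laws of the scaled chains have `∫ e^{bu²}`
bounded in `k`. [folklore] -/
theorem stub_moments (a κ₀ : ℝ) (ha : 0 < a) (hκ₀ : 0 < κ₀)
    (htransfer : ∀ (N : ℕ) (K w : ℕ → ℝ) (z : ℂ),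
      ∫ u, Complex.exp (z * u)
          ∂(isingMagnetizationLaw (N + 1) (chainJ (N + 1) K) (fun i => w i.val) : Measure ℝ) =
        (sdIter z w (fun m => Real.tanh (K m)) N).1 / 2)
    (hcone : ∀ (h η : ℝ), 0 ≤ h → 0 < η → ∀ (c κ : ℕ → ℝ), (∀ m, 0 ≤ c m ∧ c m ≤ 1) →
      (∀ m, 0 ≤ κ m ∧ κ m ≤ 1) → min 1 (h * η) ≤ κ 0 →
      (∀ m, κ (m + 1) = 1 ∨ (κ m ≤ κ (m + 1) ∧ 2 * h * η ≤ (1 - c m) * κ (m + 1))) →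
      ∀ M : ℕ, (sdIter (h : ℂ) (fun _ => η) c M).1.im = 0 ∧ 0 < (sdIter (h : ℂ) (fun _ => η) c M).1.re ∧
        (sdIter (h : ℂ) (fun _ => η) c M).1.re ≤
          2 * Real.exp ((M + 1) * (h * η) ^ 2 / 2 + h * η * ∑ m ∈ Finset.range M, κ m))
    (hr1 : ∀ t : ℝ, a * Real.exp t ≤ flipRate a t) (b : ℝ) :
    ∃ C : ℝ, ∀ k : ℕ, ∫ u, Real.exp (b * u ^ 2)
      ∂(isingMagnetizationLaw (nBonds k + 1) (chainJ (nBonds k + 1) (chainK a k))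
          (fun _ => mesh k / κ₀) : Measure ℝ) ≤ C := by
  -- Notation for the laws
  set ν : ℕ → Measure ℝ := fun k => (isingMagnetizationLaw (nBonds k + 1)
    (chainJ (nBonds k + 1) (chainK a k)) (fun _ => mesh k / κ₀) : Measure ℝ) with hνdef
  -- Step 1: the Laplace bound `∫ e^{hu} dν_k ≤ exp(A|h|√|h| + ε_k h²)`
  set A : ℝ := 2 * Real.sqrt 2 / Real.sqrt a / (κ₀ * Real.sqrt κ₀) with hAdef
  have hA : 0 ≤ A := by positivity
  set ε : ℕ → ℝ := fun k => 5 * (mesh k * (horizon k + 1)) / κ₀ ^ 2 with hεdef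
  have hε0 : ∀ k, 0 ≤ ε k := fun k => by
    have := (mesh_pos' k).2.2; have := horizon_pos' k; positivity
  have hmgf_pos : ∀ k (h : ℝ), 0 ≤ h → ∫ u, Real.exp (h * u) ∂(ν k) ≤
      Real.exp (A * (h * Real.sqrt h) + ε k * h ^ 2) := by
    intro k h hh
    have h0 : 0 ≤ h / κ₀ := div_nonneg hh hκ₀.le
    obtain ⟨him, hle⟩ := cone_chain hcone hr1 ha k h0
    have heq := mgf_ofReal_eq (κ₀ := κ₀) htransfer hr1 ha k h
    set X := (sdIter ((h / κ₀ : ℝ) : ℂ) (fun _ => mesh k) (bondTanh a k) (nBonds k)).1 with hX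
    have hXre : X = ((X.re : ℝ) : ℂ) := by
      apply Complex.ext <;> simp [him]
    have hval : ∫ u, Real.exp (h * u) ∂(ν k) = X.re / 2 := by
      apply Complex.ofReal_injective
      rw [hνdef]
      dsimp only
      rw [heq, hXre]
      push_cast
      simp
    rw [hval]
    have hexp := exponent_le ha k h0
    calc X.re / 2 ≤ Real.exp ((nBonds k + 1) * (h / κ₀ * mesh k) ^ 2 / 2 + h / κ₀ * mesh k *
          ∑ m ∈ Finset.range (nBonds k),
            min 1 (max (2 * (h / κ₀) * Real.exp (-siteTime k m) / a) (4 * (h / κ₀) * mesh k))) := by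
          linarith
      _ ≤ Real.exp (2 * Real.sqrt 2 / Real.sqrt a * (h / κ₀ * Real.sqrt (h / κ₀)) +
            5 * (mesh k * (horizon k + 1)) * (h / κ₀) ^ 2) := Real.exp_le_exp.2 hexp
      _ = Real.exp (A * (h * Real.sqrt h) + ε k * h ^ 2) := by
          congr 1
          rw [hAdef, hεdef, Real.sqrt_div' _ hκ₀.le]
          field_simp
  have hmgf : ∀ k (h : ℝ), ∫ u, Real.exp (h * u) ∂(ν k) ≤
      Real.exp (A * (|h| * Real.sqrt |h|) + ε k * h ^ 2) := by
    intro k h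
    rcases le_or_gt 0 h with hh | hh
    · rw [abs_of_nonneg hh]; exact hmgf_pos k h hh
    · have := hmgf_pos k (-h) (by linarith)
      rw [hνdef] at this ⊢
      dsimp only at this ⊢
      rw [mgf_even'] at this
      rw [abs_of_neg hh]
      simpa [neg_sq] using this
  -- Step 2: the case `b ≤ 0` is trivial
  rcases le_or_gt b 0 with hb | hb
  · refine ⟨1, fun k => ?_⟩
    have hint : Integrable (fun u => Real.exp (b * u ^ 2)) (ν k) := by
      rw [hνdef]
      exact Literature.Probability.LatticeModels.integrable_isingMagnetizationLaw _ _
        (by fun_prop : Continuous fun u : ℝ => Real.exp (b * u ^ 2)).stronglyMeasurable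
    haveI : IsProbabilityMeasure (ν k) := by rw [hνdef]; infer_instance
    calc ∫ u, Real.exp (b * u ^ 2) ∂(ν k) ≤ ∫ _u, (1 : ℝ) ∂(ν k) := by
          refine integral_mono hint (integrable_const 1) fun u => ?_
          rw [Real.exp_le_one_iff]
          nlinarith [sq_nonneg u]
      _ = 1 := by simp
  -- Step 3: `b > 0`: large `k` by Hubbard–Stratonovich, small `k` by the support bound
  set Cstar : ℝ := ∫ g, ProbabilityTheory.gaussianPDFReal 0 1 g *
      Real.exp (A * ((Real.sqrt (2 * b) * |g|) * Real.sqrt (Real.sqrt (2 * b) * |g|)) + g ^ 2 / 4)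
    with hCstar
  have hCstar0 : 0 ≤ Cstar := integral_nonneg fun g => by
    have := ProbabilityTheory.gaussianPDFReal_nonneg 0 1 g; positivity
  -- `ε_k → 0`, hence eventually `8 b ε_k ≤ 1`
  have hεlim : Tendsto ε atTop (𝓝 0) := by
    have hup : ∀ k, ε k ≤ 5 * (2 / ((k : ℝ) + 2)) / κ₀ ^ 2 := fun k => by
      show 5 * (mesh k * (horizon k + 1)) / κ₀ ^ 2 ≤ 5 * (2 / ((k : ℝ) + 2)) / κ₀ ^ 2
      gcongr
      exact mesh_mul_le' k
    have hlim2 : Tendsto (fun k : ℕ => 5 * (2 / ((k : ℝ) + 2)) / κ₀ ^ 2) atTop (𝓝 (5 * 0 / κ₀ ^ 2)) := by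
      refine ((tendsto_const_nhds.div_atTop ?_).const_mul 5).div_const _
      exact tendsto_natCast_atTop_atTop.atTop_add tendsto_const_nhds
    rw [mul_zero, zero_div] at hlim2
    exact squeeze_zero hε0 hup hlim2
  obtain ⟨k₀, hk₀⟩ : ∃ k₀ : ℕ, ∀ k ≥ k₀, ε k ≤ 1 / (8 * b) := by
    have hev := (hεlim.eventually (gt_mem_nhds (show (0 : ℝ) < 1 / (8 * b) by positivity)))
    obtain ⟨k₀, hk₀⟩ := Filter.eventually_atTop.1 hev
    exact ⟨k₀, fun k hk => (hk₀ k hk).le⟩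
  have hlarge : ∀ k ≥ k₀, ∫ u, Real.exp (b * u ^ 2) ∂(ν k) ≤ Cstar := by
    intro k hk
    have hbε : 8 * b * ε k ≤ 1 := by
      have := hk₀ k hk
      rw [le_div_iff₀ (by positivity)] at this
      linarith
    rw [hνdef]
    exact integral_exp_mul_sq_isingMagnetizationLaw_le_of_mgf_le _ _ hA hb hbε
      (fun h => by simpa [hνdef] using hmgf k h)
  -- small `k`
  set Csmall : ℝ := ∑ k ∈ Finset.range k₀,
      Real.exp (b * ((nBonds k + 1) * (mesh k / κ₀)) ^ 2) with hCsmall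
  refine ⟨Cstar + Csmall, fun k => ?_⟩
  rcases le_or_gt k₀ k with hk | hk
  · have h1 := hlarge k hk
    have h2 : 0 ≤ Csmall := Finset.sum_nonneg fun _ _ => (Real.exp_pos _).le
    linarith
  · have h1 : ∫ u, Real.exp (b * u ^ 2) ∂(ν k) ≤ Real.exp (b * ((nBonds k + 1) * (mesh k / κ₀)) ^ 2) := by
      rw [hνdef]; exact integral_exp_mul_sq_le_support hκ₀ k hb.le
    have h2 : Real.exp (b * ((nBonds k + 1) * (mesh k / κ₀)) ^ 2) ≤ Csmall :=
      Finset.single_le_sum (f := fun k => Real.exp (b * ((nBonds k + 1) * (mesh k / κ₀)) ^ 2))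
        (fun _ _ => (Real.exp_pos _).le) (Finset.mem_range.2 hk)
    linarith

end Summit.RiemannHypothesis.RiemannHypothesis.Theorems.LeeYangTelegraph

end
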